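import Literature.MathematicalPhysics.QuantumLattice.OverlapLocality
import HarnessLib

/-!
# Wilson hopping matrices: entries, action on fermion fields, flat-section identity, finite propagation

API around the Wilson hopping matrix `W_μ = F_μ ⊗ P⁻_μ + F_μᴴ ⊗ P⁺_μ` of `OverlapLocality`
(`(F_μψ)(x) = ρ(U(x,μ))ψ(x+μ̂)`, `P^∓_μ = ½(1 ∓ γ_μ)`; Hernández–Jansen–Lüscher (2.13)), for every group-valued gauge
field `U` and representation `ρ` on a periodic lattice:

* `wilsonHop_apply_eq`, `wilsonHop_mulVec_apply` — entries and the action on a fermion field (forward colour transport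
  through `P⁻_μ` plus backward colour transport through `P⁺_μ`);
* `sum_norm_sq_wilsonHop_mulVec_sub_smul` — for unitary `ρ` and a unit `u ∈ ℂ` the EXACT IDENTITY
  `Σ_p |(W_μψ)(p) − uψ(p)|² = Σ_x ‖ψ(x) − ρ(U(x,μ)) ψ(x+μ̂) (ūP⁻_μ + uP⁺_μ)ᵀ‖_F²` (`ψ(x)` as an `N × 4` colour–spin
  matrix): a near-eigenvector of `W_μ` is a flat section of the UNITARY connection `(ūP⁻_μ + uP⁺_μ) ⊗ ρ(U(x,μ))`
  (`= e^{iαγ_μ} ⊗ ρ(U)` for `u = e^{iα}`).  Proof: the site defect splits into `P⁻`- and `P⁺`-components, orthogonal since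
  `P⁻P⁺ = 0`; the `P⁺`-terms are re-indexed by `x ↦ x+μ̂` and rotated by the unitary `ρ(U(x,μ))`, the `P⁻`-terms multiplied
  by the unit `−ū`; recombine with `P⁻ + P⁺ = 1`;
* finite propagation: `K_U = Σ_μ W_μ` is nearest-neighbour (`wilsonHopSum_mulVec_apply_eq_zero`), hence for any
  nearest-neighbour matrix `K`, any neighbour-closed chain of site sets `A 0 ⊆ ⋯ ⊆ A n` and any `ψ` supported on `A 0`,
  `Kʲψ = (PKP)ʲψ` with `P` the coordinate projection onto `A n` (`pow_mulVec_eq_compressed_of_local`) and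
  `Σ_p |(Kⁿψ)(p)|² ≤ ‖PKP‖^{2n} Σ_p |ψ(p)|²` in the `ℓ²` operator norm (`sum_norm_sq_pow_mulVec_le_of_local`,
  `sum_norm_sq_wilsonHopSum_pow_mulVec_le`).

Finite-dimensional linear algebra on the explicit matrix `wilsonHop`. [cite: HernandezJansenLuscher1999, (2.13)]
-/

namespace Literature.MathematicalPhysics.QuantumLattice

open scoped BigOperators ComplexConjugate
open Matrix Literature.MathematicalPhysics.QuantumFieldTheory Literature.Probability.LatticeModels

variable {L N : ℕ} {G : Type*} [Group G] (ρ : G →* Matrix (Fin N) (Fin N) ℂ)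
section Entries

/-- Entries of the Wilson hopping matrix: `W_μ((x,a,s),(y,b,t)) = δ_{y,x+μ̂} ρ(U(x,μ))_{ab} (P⁻_μ)_{st}
+ δ_{x,y+μ̂} conj(ρ(U(y,μ))_{ba}) (P⁺_μ)_{st}`. [folklore] -/
theorem wilsonHop_apply_eq (U : GaugeConfig 4 L G) (μ : Fin 4) (x y : TorusSite 4 L) (a b : Fin N)
    (s t : Fin 4) :
    wilsonHop ρ U μ (x, a, s) (y, b, t) =
      (if y = Site.shift x μ then ρ (U (x, μ)) a b else 0) * chiralProjMinus μ s t +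
        (if x = Site.shift y μ then star (ρ (U (y, μ)) b a) else 0) * chiralProjPlus μ s t := by
  simp only [wilsonHop, linkHop, Matrix.reindex_apply, Matrix.submatrix_apply, Equiv.prodAssoc_symm_apply,
    Matrix.add_apply, Matrix.kroneckerMap_apply, Matrix.conjTranspose_apply, Matrix.of_apply, star_ite_zero]

variable [NeZero L]

/-- The Wilson hopping matrix applied to a fermion field: forward colour transport through `P⁻_μ` plus backward
colour transport through `P⁺_μ`,
`(W_μψ)(x,a,s) = Σ_{b,t} ρ(U(x,μ))_{ab} (P⁻_μ)_{st} ψ(x+μ̂,b,t) + Σ_{b,t} conj(ρ(U(x−μ̂,μ))_{ba}) (P⁺_μ)_{st} ψ(x−μ̂,b,t)`. [folklore] -/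
theorem wilsonHop_mulVec_apply (U : GaugeConfig 4 L G) (μ : Fin 4)
    (ψ : TorusSite 4 L × Fin N × Fin 4 → ℂ) (x : TorusSite 4 L) (a : Fin N) (s : Fin 4) :
    (wilsonHop ρ U μ *ᵥ ψ) (x, a, s) =
      (∑ b, ∑ t, ρ (U (x, μ)) a b * chiralProjMinus μ s t * ψ (Site.shift x μ, b, t)) +
        ∑ b, ∑ t, star (ρ (U (x - Pi.single μ 1, μ)) b a) * chiralProjPlus μ s t *
          ψ (x - Pi.single μ 1, b, t) := by
  simp only [Matrix.mulVec, dotProduct, Fintype.sum_prod_type, wilsonHop_apply_eq, add_mul,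
    Finset.sum_add_distrib, eq_shift_iff x]
  simp only [ite_mul, zero_mul, Finset.sum_ite_irrel, Finset.sum_const_zero, Finset.sum_ite_eq',
    Finset.mem_univ, if_true]

end Entries

section Frobenius

variable {m n k : Type*} [Fintype m] [Fintype n] [Fintype k]

/-- The squared Frobenius norm as the real part of `tr(Mᴴ M)`. [folklore] -/
theorem sum_norm_sq_eq_re_trace_conjTranspose_mul (M : Matrix m n ℂ) :
    ∑ i, ∑ j, ‖M i j‖ ^ 2 = ((Mᴴ * M).trace).re := by
  rw [Matrix.trace, Finset.sum_comm]
  simp only [Matrix.diag_apply, Matrix.mul_apply, Matrix.conjTranspose_apply, Complex.re_sum]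
  refine Finset.sum_congr rfl fun j _ => Finset.sum_congr rfl fun i _ => ?_
  rw [Complex.star_def, ← Complex.normSq_eq_conj_mul_self, Complex.normSq_eq_norm_sq, Complex.ofReal_re]

/-- Pythagoras for right factors with `X Yᴴ = 0 = Y Xᴴ`: the Frobenius form of `A X + B Y` splits. [folklore] -/
theorem trace_conjTranspose_mul_add_of_orthogonal (A B : Matrix m k ℂ) (X Y : Matrix k n ℂ)
    (hXY : X * Yᴴ = 0) (hYX : Y * Xᴴ = 0) :
    ((A * X + B * Y)ᴴ * (A * X + B * Y)).trace =
      ((A * X)ᴴ * (A * X)).trace + ((B * Y)ᴴ * (B * Y)).trace := by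
  have h1 : ((A * X)ᴴ * (B * Y)).trace = 0 := by
    rw [conjTranspose_mul, Matrix.mul_assoc, Matrix.trace_mul_comm, Matrix.mul_assoc, Matrix.mul_assoc,
      hYX, Matrix.mul_zero, Matrix.mul_zero, Matrix.trace_zero]
  have h2 : ((B * Y)ᴴ * (A * X)).trace = 0 := by
    rw [conjTranspose_mul, Matrix.mul_assoc, Matrix.trace_mul_comm, Matrix.mul_assoc, Matrix.mul_assoc,
      hXY, Matrix.mul_zero, Matrix.mul_zero, Matrix.trace_zero]
  rw [conjTranspose_add, Matrix.add_mul, Matrix.mul_add, Matrix.mul_add, trace_add, trace_add, trace_add, h1,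
    h2, add_zero, zero_add]

/-- Left multiplication by a co-isometry (`Vᴴ V = 1`) preserves the Frobenius form. [folklore] -/
theorem trace_conjTranspose_mul_isometry_mul [DecidableEq m] (V : Matrix m m ℂ) (hV : Vᴴ * V = 1) (M : Matrix m n ℂ) :
    ((V * M)ᴴ * (V * M)).trace = (Mᴴ * M).trace := by
  rw [conjTranspose_mul, Matrix.mul_assoc, ← Matrix.mul_assoc Vᴴ, hV, Matrix.one_mul]

/-- Scaling by `c` scales the Frobenius form by `|c|²`. [folklore] -/
theorem trace_conjTranspose_mul_smul (c : ℂ) (M : Matrix m n ℂ) :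
    ((c • M)ᴴ * (c • M)).trace = (‖c‖ ^ 2 : ℂ) * (Mᴴ * M).trace := by
  rw [conjTranspose_smul, Matrix.smul_mul, Matrix.mul_smul, smul_smul, trace_smul, smul_eq_mul, Complex.star_def,
    ← Complex.normSq_eq_conj_mul_self, Complex.normSq_eq_norm_sq]
  push_cast
  ring

end Frobenius

section Spin

/-- The transposed chiral projectors are complementary: `P⁻ᵀ + P⁺ᵀ = 1`. [folklore] -/
theorem chiralProjMinus_transpose_add_chiralProjPlus_transpose (μ : Fin 4) : (chiralProjMinus μ)ᵀ + (chiralProjPlus μ)ᵀ = 1 := by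
  rw [← transpose_add, chiralProjMinus_add_chiralProjPlus, transpose_one]

/-- `(Pᵀ)ᴴ = Pᵀ` for a Hermitian `P`. [folklore] -/
theorem conjTranspose_transpose_of_conjTranspose_eq {ι : Type*} {P : Matrix ι ι ℂ} (hP : Pᴴ = P) :
    (Pᵀ)ᴴ = Pᵀ := by
  ext i j
  have h := congrFun (congrFun hP j) i
  rw [conjTranspose_apply] at h
  rw [conjTranspose_apply, transpose_apply, transpose_apply, h]

/-- Orthogonality of the transposed chiral projectors: `P⁻ᵀ (P⁺ᵀ)ᴴ = 0`. [folklore] -/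
theorem chiralProjMinus_transpose_mul_conjTranspose_chiralProjPlus_transpose (μ : Fin 4) :
    (chiralProjMinus μ)ᵀ * ((chiralProjPlus μ)ᵀ)ᴴ = 0 := by
  rw [conjTranspose_transpose_of_conjTranspose_eq (chiralProjPlus_conjTranspose μ), ← transpose_mul,
    chiralProjPlus_mul_chiralProjMinus, transpose_zero]

/-- Orthogonality of the transposed chiral projectors: `P⁺ᵀ (P⁻ᵀ)ᴴ = 0`. [folklore] -/
theorem chiralProjPlus_transpose_mul_conjTranspose_chiralProjMinus_transpose (μ : Fin 4) :
    (chiralProjPlus μ)ᵀ * ((chiralProjMinus μ)ᵀ)ᴴ = 0 := by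
  rw [conjTranspose_transpose_of_conjTranspose_eq (chiralProjMinus_conjTranspose μ), ← transpose_mul,
    chiralProjMinus_mul_chiralProjPlus, transpose_zero]

end Spin

section Main

variable [NeZero L]

/-- **Site-matrix form of the hopping defect.**  With `v(x) = ψ(x,·,·)` as an `N × 4` matrix,
`T(x) = ρ(U(x,μ)) v(x+μ̂)`, `S(x) = ρ(U(x−μ̂,μ))ᴴ v(x−μ̂)`, `X = P⁻ᵀ`, `Y = P⁺ᵀ`:
`(W_μψ − uψ)(x) = (T(x) − u v(x)) X + (S(x) − u v(x)) Y`. [folklore] -/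
theorem wilsonHop_mulVec_sub_smul_apply_eq (U : GaugeConfig 4 L G) (μ : Fin 4) (ψ : TorusSite 4 L × Fin N × Fin 4 → ℂ)
    (u : ℂ) (x : TorusSite 4 L) (a : Fin N) (s : Fin 4) :
    (wilsonHop ρ U μ *ᵥ ψ) (x, a, s) - u * ψ (x, a, s) =
      ((ρ (U (x, μ)) * Matrix.of (fun b t => ψ (Site.shift x μ, b, t)) -
            u • Matrix.of (fun b t => ψ (x, b, t))) * (chiralProjMinus μ)ᵀ +
        ((ρ (U (x - Pi.single μ 1, μ)))ᴴ * Matrix.of (fun b t => ψ (x - Pi.single μ 1, b, t)) -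
            u • Matrix.of (fun b t => ψ (x, b, t))) * (chiralProjPlus μ)ᵀ) a s := by
  set v₀ : Matrix (Fin N) (Fin 4) ℂ := Matrix.of fun b t => ψ (x, b, t) with hv₀
  set T : Matrix (Fin N) (Fin 4) ℂ := ρ (U (x, μ)) * Matrix.of (fun b t => ψ (Site.shift x μ, b, t)) with hT
  set S : Matrix (Fin N) (Fin 4) ℂ :=
    (ρ (U (x - Pi.single μ 1, μ)))ᴴ * Matrix.of (fun b t => ψ (x - Pi.single μ 1, b, t)) with hS
  have halg : (T - u • v₀) * (chiralProjMinus μ)ᵀ + (S - u • v₀) * (chiralProjPlus μ)ᵀ =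
      T * (chiralProjMinus μ)ᵀ + S * (chiralProjPlus μ)ᵀ - u • v₀ := by
    have h1 : u • v₀ = u • (v₀ * ((chiralProjMinus μ)ᵀ + (chiralProjPlus μ)ᵀ)) := by
      rw [chiralProjMinus_transpose_add_chiralProjPlus_transpose, Matrix.mul_one]
    rw [Matrix.sub_mul, Matrix.sub_mul, Matrix.smul_mul, Matrix.smul_mul]
    conv_rhs => rw [h1, Matrix.mul_add, smul_add]
    abel
  rw [halg, wilsonHop_mulVec_apply]
  simp only [Matrix.sub_apply, Matrix.add_apply, Matrix.smul_apply, Matrix.mul_apply, transpose_apply,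
    conjTranspose_apply, Matrix.of_apply, smul_eq_mul, hT, hS, hv₀]
  congr 1
  congr 1
  · rw [Finset.sum_comm]
    refine Finset.sum_congr rfl fun t _ => ?_
    rw [Finset.sum_mul]
    exact Finset.sum_congr rfl fun b _ => by ring
  · rw [Finset.sum_comm]
    refine Finset.sum_congr rfl fun t _ => ?_
    rw [Finset.sum_mul]
    exact Finset.sum_congr rfl fun b _ => by ring

/-- **Near-eigenvectors of `W_μ` are flat sections of the twisted unitary connection.**  For unitary `ρ`,
every gauge field `U`, direction `μ`, fermion field `ψ` and unit `u ∈ ℂ`: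
`Σ_p |(W_μψ)(p) − uψ(p)|² = Σ_x ‖ ψ(x) − ρ(U(x,μ)) ψ(x+μ̂) (ū P⁻_μ + u P⁺_μ)ᵀ ‖_F²`
(`ψ(x)` as an `N × 4` colour–spin matrix).  The connection `(ū P⁻_μ + u P⁺_μ) ⊗ ρ(U(x,μ))` is unitary
(`= e^{iαγ_μ} ⊗ ρ(U)` for `u = e^{iα}`), so θ-flat vectors of the local numerical range of `K_U = Σ_μ W_μ` are
`√(8θ)`-flat covariantly constant sections, direction by direction. [folklore] -/
theorem sum_norm_sq_wilsonHop_mulVec_sub_smul (hρ : ∀ g, ρ g ∈ Matrix.unitaryGroup (Fin N) ℂ) (U : GaugeConfig 4 L G)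
    (μ : Fin 4) (ψ : TorusSite 4 L × Fin N × Fin 4 → ℂ) {u : ℂ} (hu : ‖u‖ = 1) :
    ∑ p, ‖(wilsonHop ρ U μ *ᵥ ψ) p - u * ψ p‖ ^ 2 =
      ∑ x, ∑ a, ∑ s, ‖((Matrix.of fun b t => ψ (x, b, t)) -
        ρ (U (x, μ)) * (Matrix.of fun b t => ψ (Site.shift x μ, b, t)) *
          (conj u • chiralProjMinus μ + u • chiralProjPlus μ)ᵀ) a s‖ ^ 2 := by
  -- notation
  set e : TorusSite 4 L := Pi.single μ 1 with he
  set X : Matrix (Fin 4) (Fin 4) ℂ := (chiralProjMinus μ)ᵀ with hX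
  set Y : Matrix (Fin 4) (Fin 4) ℂ := (chiralProjPlus μ)ᵀ with hY
  let v : TorusSite 4 L → Matrix (Fin N) (Fin 4) ℂ := fun x => Matrix.of fun b t => ψ (x, b, t)
  let T : TorusSite 4 L → Matrix (Fin N) (Fin 4) ℂ := fun x => ρ (U (x, μ)) * v (Site.shift x μ)
  let S : TorusSite 4 L → Matrix (Fin N) (Fin 4) ℂ := fun x => (ρ (U (x - e, μ)))ᴴ * v (x - e)
  have hXY : X * Yᴴ = 0 := chiralProjMinus_transpose_mul_conjTranspose_chiralProjPlus_transpose μ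
  have hYX : Y * Xᴴ = 0 := chiralProjPlus_transpose_mul_conjTranspose_chiralProjMinus_transpose μ
  have hshift : ∀ x : TorusSite 4 L, Site.shift x μ = x + e := fun x => rfl
  have hVV : ∀ x : TorusSite 4 L, (ρ (U (x, μ)))ᴴ * ρ (U (x, μ)) = 1 := fun x =>
    Matrix.mem_unitaryGroup_iff'.mp (hρ _)
  have hVV' : ∀ x : TorusSite 4 L, ρ (U (x, μ)) * (ρ (U (x, μ)))ᴴ = 1 := fun x =>
    Matrix.mem_unitaryGroup_iff.mp (hρ _)
  -- Stage B: sum over sites of the Frobenius form of the site defect matrix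
  have hB : ∑ p, ‖(wilsonHop ρ U μ *ᵥ ψ) p - u * ψ p‖ ^ 2 =
      ∑ x, ((((T x - u • v x) * X + (S x - u • v x) * Y)ᴴ *
        ((T x - u • v x) * X + (S x - u • v x) * Y)).trace).re := by
    rw [Fintype.sum_prod_type]
    refine Finset.sum_congr rfl fun x _ => ?_
    rw [Fintype.sum_prod_type, ← sum_norm_sq_eq_re_trace_conjTranspose_mul]
    refine Finset.sum_congr rfl fun a _ => Finset.sum_congr rfl fun s _ => ?_
    rw [wilsonHop_mulVec_sub_smul_apply_eq ρ U μ ψ u x a s]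
  -- Stage D: the `P⁺` terms, re-indexed by `x ↦ x + e` and rotated by the unitary `ρ(U(x,μ))`
  have hP : ∀ x, (((S (x + e) - u • v (x + e)) * Y)ᴴ * ((S (x + e) - u • v (x + e)) * Y)).trace =
      (((v x - u • T x) * Y)ᴴ * ((v x - u • T x) * Y)).trace := by
    intro x
    have hSx : S (x + e) = (ρ (U (x, μ)))ᴴ * v x := by
      show (ρ (U (x + e - e, μ)))ᴴ * v (x + e - e) = _
      rw [add_sub_cancel_right]
    have hVM : ρ (U (x, μ)) * (((ρ (U (x, μ)))ᴴ * v x - u • v (x + e)) * Y) = (v x - u • T x) * Y := by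
      rw [← Matrix.mul_assoc, Matrix.mul_sub, ← Matrix.mul_assoc, hVV', Matrix.one_mul, Matrix.mul_smul,
        ← hshift]
    rw [hSx, ← trace_conjTranspose_mul_isometry_mul (ρ (U (x, μ))) (hVV x), hVM]
  -- Stage E: the `P⁻` terms, multiplied by the unit `−ū`
  have huu : conj u * u = 1 := by
    rw [← Complex.normSq_eq_conj_mul_self, Complex.normSq_eq_norm_sq, hu]; norm_num
  have hc : ((‖-conj u‖ : ℂ)) ^ 2 = 1 := by
    rw [norm_neg, Complex.norm_conj, hu]; norm_num
  have hM : ∀ x, (((T x - u • v x) * X)ᴴ * ((T x - u • v x) * X)).trace =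
      (((v x - conj u • T x) * X)ᴴ * ((v x - conj u • T x) * X)).trace := by
    intro x
    have hmat' : (-conj u) • (T x - u • v x) = v x - conj u • T x := by
      rw [smul_sub, smul_smul, neg_mul, huu, neg_smul, neg_smul, one_smul, sub_neg_eq_add, add_comm,
        ← sub_eq_add_neg]
    have hmat : (v x - conj u • T x) * X = (-conj u) • ((T x - u • v x) * X) := by
      conv_rhs => rw [← Matrix.smul_mul, hmat']
    rw [hmat, trace_conjTranspose_mul_smul, hc, one_mul]
  -- Stage F: recombination `(v − ūT)X + (v − uT)Y = v − T (ūX + uY)`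
  have hF : ∀ x, (v x - conj u • T x) * X + (v x - u • T x) * Y =
      v x - ρ (U (x, μ)) * v (Site.shift x μ) * (conj u • chiralProjMinus μ + u • chiralProjPlus μ)ᵀ := by
    intro x
    rw [transpose_add, transpose_smul, transpose_smul, Matrix.mul_add, Matrix.mul_smul, Matrix.mul_smul,
      Matrix.sub_mul, Matrix.sub_mul, Matrix.smul_mul, Matrix.smul_mul]
    have h1 : v x * X + v x * Y = v x := by rw [← Matrix.mul_add, chiralProjMinus_transpose_add_chiralProjPlus_transpose, Matrix.mul_one]
    rw [show v x * X - conj u • (T x * X) + (v x * Y - u • (T x * Y)) =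
        (v x * X + v x * Y) - (conj u • (T x * X) + u • (T x * Y)) by abel, h1]
  -- assembly
  rw [hB]
  have hsplit : ∀ x, ((((T x - u • v x) * X + (S x - u • v x) * Y)ᴴ *
      ((T x - u • v x) * X + (S x - u • v x) * Y)).trace).re =
      ((((T x - u • v x) * X)ᴴ * ((T x - u • v x) * X)).trace).re +
        ((((S x - u • v x) * Y)ᴴ * ((S x - u • v x) * Y)).trace).re := fun x => by
    rw [trace_conjTranspose_mul_add_of_orthogonal _ _ X Y hXY hYX, Complex.add_re]
  simp only [hsplit, Finset.sum_add_distrib]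
  have hreidx : ∑ x, ((((S x - u • v x) * Y)ᴴ * ((S x - u • v x) * Y)).trace).re =
      ∑ x, ((((v x - u • T x) * Y)ᴴ * ((v x - u • T x) * Y)).trace).re := by
    rw [← Equiv.sum_comp (Equiv.addRight e)]
    simp only [Equiv.coe_addRight, hP]
  rw [hreidx]
  simp only [hM]
  rw [← Finset.sum_add_distrib]
  refine Finset.sum_congr rfl fun x _ => ?_
  rw [← Complex.add_re, ← trace_conjTranspose_mul_add_of_orthogonal _ _ X Y hXY hYX, hF, sum_norm_sq_eq_re_trace_conjTranspose_mul]

end Main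

section Propagation

variable [NeZero L]

open scoped Matrix.Norms.L2Operator

/-- **Finite propagation of the hopping operator.**  If `ψ` vanishes at every site outside `A`, then
`K_U ψ = (Σ_μ W_μ) ψ` vanishes at every site `x` none of whose neighbours `x ± μ̂` lies in `A`. [folklore] -/
theorem wilsonHopSum_mulVec_apply_eq_zero (U : GaugeConfig 4 L G) (ψ : TorusSite 4 L × Fin N × Fin 4 → ℂ)
    {A : Set (TorusSite 4 L)} (hψ : ∀ p, p.1 ∉ A → ψ p = 0) {x : TorusSite 4 L}
    (hx : ∀ μ, Site.shift x μ ∉ A ∧ x - Pi.single μ 1 ∉ A) (a : Fin N) (s : Fin 4) :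
    ((∑ μ, wilsonHop ρ U μ) *ᵥ ψ) (x, a, s) = 0 := by
  rw [Matrix.sum_mulVec, Finset.sum_apply]
  refine Finset.sum_eq_zero fun μ _ => ?_
  rw [wilsonHop_mulVec_apply]
  have h1 : ∀ b t, ψ (Site.shift x μ, b, t) = 0 := fun b t => hψ _ (hx μ).1
  have h2 : ∀ b t, ψ (x - Pi.single μ 1, b, t) = 0 := fun b t => hψ _ (hx μ).2
  simp only [h1, h2, mul_zero, Finset.sum_const_zero, add_zero]

/-- **Compression identity.**  Let `K` be any matrix on fermion indices that is NEAREST-NEIGHBOUR in the sense of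
`wilsonHopSum_mulVec_apply_eq_zero` (hypothesis `hloc`).  If `φ` vanishes off `A ⊆ B` and no site outside `B` has a
neighbour in `A`, then `K φ = (P_B K P_B) φ` for the coordinate projection `P_B` onto the sites of `B`. [folklore] -/
theorem mulVec_eq_compressed_of_local
    (K : Matrix (TorusSite 4 L × Fin N × Fin 4) (TorusSite 4 L × Fin N × Fin 4) ℂ)
    (hloc : ∀ (φ : TorusSite 4 L × Fin N × Fin 4 → ℂ) (A : Set (TorusSite 4 L)) (x : TorusSite 4 L),
      (∀ p, p.1 ∉ A → φ p = 0) → (∀ μ, Site.shift x μ ∉ A ∧ x - Pi.single μ 1 ∉ A) →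
        ∀ (a : Fin N) (s : Fin 4), (K *ᵥ φ) (x, a, s) = 0)
    (φ : TorusSite 4 L × Fin N × Fin 4 → ℂ) {A B : Set (TorusSite 4 L)} [DecidablePred (· ∈ B)] (hAB : A ⊆ B)
    (hnb : ∀ x, x ∉ B → ∀ μ, Site.shift x μ ∉ A ∧ x - Pi.single μ 1 ∉ A)
    (hφ : ∀ p, p.1 ∉ A → φ p = 0) :
    K *ᵥ φ =
      (Matrix.diagonal (fun p : TorusSite 4 L × Fin N × Fin 4 => if p.1 ∈ B then (1 : ℂ) else 0) * K *
        Matrix.diagonal (fun p : TorusSite 4 L × Fin N × Fin 4 => if p.1 ∈ B then (1 : ℂ) else 0)) *ᵥ φ := by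
  set P : Matrix (TorusSite 4 L × Fin N × Fin 4) (TorusSite 4 L × Fin N × Fin 4) ℂ :=
    Matrix.diagonal (fun p => if p.1 ∈ B then (1 : ℂ) else 0) with hP
  have hPφ : P *ᵥ φ = φ := by
    ext p
    rw [hP, Matrix.mulVec_diagonal]
    by_cases hp : p.1 ∈ B
    · rw [if_pos hp, one_mul]
    · rw [if_neg hp, zero_mul, hφ p (fun h => hp (hAB h))]
  have hPK : P *ᵥ (K *ᵥ φ) = K *ᵥ φ := by
    ext p
    rw [hP, Matrix.mulVec_diagonal]
    by_cases hp : p.1 ∈ B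
    · rw [if_pos hp, one_mul]
    · obtain ⟨x, a, s'⟩ := p
      rw [if_neg hp, zero_mul, hloc φ A x hφ (hnb x hp) a s']
  rw [← Matrix.mulVec_mulVec, ← Matrix.mulVec_mulVec, hPφ, hPK]

/-- **Iterated compression along a neighbour-closed chain of site sets.**  Let `A 0 ⊆ ⋯ ⊆ A n` be site sets such
that no site outside `A (j+1)` has a neighbour in `A j`, and `K` nearest-neighbour.  If `ψ` vanishes off `A 0` then for
every `j ≤ n`, `Kʲ ψ` vanishes off `A j` and `Kʲ ψ = (P K P)ʲ ψ` with `P` the projection onto the sites of `A n`. [folklore] -/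
theorem pow_mulVec_eq_compressed_of_local
    (K : Matrix (TorusSite 4 L × Fin N × Fin 4) (TorusSite 4 L × Fin N × Fin 4) ℂ)
    (hloc : ∀ (φ : TorusSite 4 L × Fin N × Fin 4 → ℂ) (A : Set (TorusSite 4 L)) (x : TorusSite 4 L),
      (∀ p, p.1 ∉ A → φ p = 0) → (∀ μ, Site.shift x μ ∉ A ∧ x - Pi.single μ 1 ∉ A) →
        ∀ (a : Fin N) (s : Fin 4), (K *ᵥ φ) (x, a, s) = 0)
    (ψ : TorusSite 4 L × Fin N × Fin 4 → ℂ) (n : ℕ) (A : ℕ → Set (TorusSite 4 L)) [DecidablePred (· ∈ A n)]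
    (hmono : ∀ j, j ≤ n → A j ⊆ A n)
    (hstep : ∀ j, j < n → ∀ x, x ∉ A (j + 1) → ∀ μ, Site.shift x μ ∉ A j ∧ x - Pi.single μ 1 ∉ A j)
    (hψ : ∀ p, p.1 ∉ A 0 → ψ p = 0) :
    ∀ j, j ≤ n →
      (∀ p, p.1 ∉ A j → (K ^ j *ᵥ ψ) p = 0) ∧
        K ^ j *ᵥ ψ =
          (Matrix.diagonal (fun p : TorusSite 4 L × Fin N × Fin 4 => if p.1 ∈ A n then (1 : ℂ) else 0) * K *
              Matrix.diagonal (fun p : TorusSite 4 L × Fin N × Fin 4 => if p.1 ∈ A n then (1 : ℂ) else 0)) ^ j *ᵥ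
            ψ := by
  set P : Matrix (TorusSite 4 L × Fin N × Fin 4) (TorusSite 4 L × Fin N × Fin 4) ℂ :=
    Matrix.diagonal (fun p => if p.1 ∈ A n then (1 : ℂ) else 0) with hP
  intro j
  induction j with
  | zero =>
    intro _
    refine ⟨fun p hp => ?_, ?_⟩
    · rw [pow_zero, Matrix.one_mulVec]; exact hψ p hp
    · rw [pow_zero, pow_zero]
  | succ j ih =>
    intro hj
    have hj' : j < n := Nat.lt_of_succ_le hj
    obtain ⟨ihsupp, iheq⟩ := ih hj'.le
    have hKj : K ^ (j + 1) *ᵥ ψ = K *ᵥ (K ^ j *ᵥ ψ) := by rw [pow_succ', Matrix.mulVec_mulVec]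
    refine ⟨fun p hp => ?_, ?_⟩
    · obtain ⟨x, a, s⟩ := p
      rw [hKj]
      exact hloc _ _ x ihsupp (hstep j hj' x hp) a s
    · have hnb : ∀ x, x ∉ A n → ∀ μ, Site.shift x μ ∉ A j ∧ x - Pi.single μ 1 ∉ A j := by
        intro x hx μ
        have hx' : x ∉ A (j + 1) := fun h => hx (hmono (j + 1) hj h)
        exact hstep j hj' x hx' μ
      have hc := mulVec_eq_compressed_of_local K hloc (K ^ j *ᵥ ψ) (hmono j hj'.le) hnb ihsupp
      rw [hKj, hc, ← hP, iheq, Matrix.mulVec_mulVec, ← pow_succ']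

/-- **Propagation bound (norm form).**  Under the hypotheses of `pow_mulVec_eq_compressed_of_local`:
`Σ_p |(Kⁿ ψ)(p)|² ≤ ‖P K P‖^{2n} Σ_p |ψ(p)|²` in the `ℓ²` operator norm — the growth of a column of `Kⁿ` is controlled
by the LOCAL operator norm of `K` compressed to the sites it can reach.  For the Wilson hopping operator
`K_U = Σ_μ W_μ` the locality hypothesis is `wilsonHopSum_mulVec_apply_eq_zero`. [folklore] -/
theorem sum_norm_sq_pow_mulVec_le_of_local
    (K : Matrix (TorusSite 4 L × Fin N × Fin 4) (TorusSite 4 L × Fin N × Fin 4) ℂ)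
    (hloc : ∀ (φ : TorusSite 4 L × Fin N × Fin 4 → ℂ) (A : Set (TorusSite 4 L)) (x : TorusSite 4 L),
      (∀ p, p.1 ∉ A → φ p = 0) → (∀ μ, Site.shift x μ ∉ A ∧ x - Pi.single μ 1 ∉ A) →
        ∀ (a : Fin N) (s : Fin 4), (K *ᵥ φ) (x, a, s) = 0)
    (ψ : TorusSite 4 L × Fin N × Fin 4 → ℂ) (n : ℕ) (hn : 0 < n) (A : ℕ → Set (TorusSite 4 L))
    [DecidablePred (· ∈ A n)]
    (hmono : ∀ j, j ≤ n → A j ⊆ A n)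
    (hstep : ∀ j, j < n → ∀ x, x ∉ A (j + 1) → ∀ μ, Site.shift x μ ∉ A j ∧ x - Pi.single μ 1 ∉ A j)
    (hψ : ∀ p, p.1 ∉ A 0 → ψ p = 0) :
    ∑ p, ‖((K ^ n) *ᵥ ψ) p‖ ^ 2 ≤
      ‖Matrix.diagonal (fun p : TorusSite 4 L × Fin N × Fin 4 => if p.1 ∈ A n then (1 : ℂ) else 0) * K *
          Matrix.diagonal (fun p : TorusSite 4 L × Fin N × Fin 4 => if p.1 ∈ A n then (1 : ℂ) else 0)‖ ^ (2 * n) *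
        ∑ p, ‖ψ p‖ ^ 2 := by
  set P : Matrix (TorusSite 4 L × Fin N × Fin 4) (TorusSite 4 L × Fin N × Fin 4) ℂ :=
    Matrix.diagonal (fun p => if p.1 ∈ A n then (1 : ℂ) else 0) with hP
  obtain ⟨-, heq⟩ := pow_mulVec_eq_compressed_of_local K hloc ψ n A hmono hstep hψ n le_rfl
  rw [← hP] at heq
  rw [heq]
  refine (sum_norm_sq_mulVec_le _ ψ).trans ?_
  refine mul_le_mul_of_nonneg_right ?_ (Finset.sum_nonneg fun i _ => by positivity)
  rw [pow_mul']
  exact pow_le_pow_left₀ (norm_nonneg _) (norm_pow_le' _ hn) 2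

/-- The propagation bound for the Wilson hopping operator `K_U = Σ_μ W_μ` itself (locality discharged). [folklore] -/
theorem sum_norm_sq_wilsonHopSum_pow_mulVec_le (U : GaugeConfig 4 L G) (ψ : TorusSite 4 L × Fin N × Fin 4 → ℂ)
    (n : ℕ) (hn : 0 < n) (A : ℕ → Set (TorusSite 4 L)) [DecidablePred (· ∈ A n)]
    (hmono : ∀ j, j ≤ n → A j ⊆ A n)
    (hstep : ∀ j, j < n → ∀ x, x ∉ A (j + 1) → ∀ μ, Site.shift x μ ∉ A j ∧ x - Pi.single μ 1 ∉ A j)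
    (hψ : ∀ p, p.1 ∉ A 0 → ψ p = 0) :
    ∑ p, ‖(((∑ μ, wilsonHop ρ U μ) ^ n) *ᵥ ψ) p‖ ^ 2 ≤
      ‖Matrix.diagonal (fun p : TorusSite 4 L × Fin N × Fin 4 => if p.1 ∈ A n then (1 : ℂ) else 0) *
            (∑ μ, wilsonHop ρ U μ) *
          Matrix.diagonal (fun p : TorusSite 4 L × Fin N × Fin 4 => if p.1 ∈ A n then (1 : ℂ) else 0)‖ ^ (2 * n) *
        ∑ p, ‖ψ p‖ ^ 2 :=
  sum_norm_sq_pow_mulVec_le_of_local (∑ μ, wilsonHop ρ U μ)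
    (fun φ _ _ hφ hx a s => wilsonHopSum_mulVec_apply_eq_zero ρ U φ hφ hx a s) ψ n hn A hmono hstep hψ

end Propagation

end Literature.MathematicalPhysics.QuantumLattice
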